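import Literature.Probability.RandomPlanarGeometry.SLERealFlowIto
import Literature.Probability.Process.PathRegularization
import HarnessLib

/-!
# The real Loewner flow of an adapted driving process with almost surely continuous paths

Infrastructure step of a proof of the named fact
`Literature.Probability.RandomPlanarGeometry.SLEKappaRho.ae_forall_ofReal_notMem_closure_hullUnion`
(`SLEKappaRhoFillVersion`; [LSW] Lemma 8.3 (2)–(3) with Thm. 8.4: for SLE(8/3, ρ) a.s. no positive
real point lies in `cl K_∞`), after

* G. F. Lawler, *Conformally Invariant Processes in the Plane*, AMS (2005), §4.1 (the chordal
  Loewner flow on the real line: `g_t(x)` is determined by the driving function up to time `t`);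
* S. Rohde, O. Schramm, *Basic properties of SLE*, Ann. of Math. **161** (2005), proof of
  Lemma 7.2 (the real flows `X_t = g_t(x) - W_t`).

The driving function of SLE(κ, ρ) ([LSW] §8.3) is `W = √κ X + O` for a Bessel process `X`, whose
paths are continuous only ALMOST surely, while the tree's measurability results for the real
Loewner flow (`Loewner.measurable_realFlowTrunc`, `LoewnerAdapted`) are stated for families of
driving paths that are continuous for EVERY sample. This file bridges the gap:

* `Loewner.IsSolution.of_eqOn_driving`, `Loewner.coe_lt_swallowingTime_of_eqOn`,
  `Loewner.map_eq_of_eqOn`, `Loewner.realFlowStop_eq_of_eqOn` — **locality in the driving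
  function** (deterministic): two continuous driving functions that agree on `[0, t]` have the
  same flow, swallowing relation `t < T_x` and frozen real flow up to time `t` (uniqueness and the
  extension criterion `IsSolution.coe_lt_swallowingTime_of_le_norm_sub`);
* `Loewner.drivingUpTo V t ω` — the path of the process `V` stopped at `t` and REGULARISED
  (`Literature.Probability.Process.pathRegularize`): continuous for every `ω`, equal to
  `s ↦ V (s ∧ t) ω` whenever the path of `V` at `ω` is continuous, and with all its values
  measurable with respect to any σ-algebra making `V s`, `s ≤ t`, measurable;
* `Loewner.flowProc V x t ω` — **the frozen real flow of the process `V` from `x`** read through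
  `drivingUpTo`: adapted to any filtration to which `V` is adapted (`Loewner.adapted_flowProc`,
  from `measurable_realFlowTrunc`), and equal to the honest frozen flow
  `realFlowStop (V · ω) x t` on every continuous path (`Loewner.flowProc_eq_of_continuous`).

No named fact is introduced.
-/

noncomputable section

open Set Filter Topology MeasureTheory
open scoped NNReal

namespace Literature.Probability.RandomPlanarGeometry

namespace Loewner

/-! ### Locality of the flow in the driving function -/

section Locality

variable {W U : ℝ≥0 → ℝ} {z : ℂ} {g : ℝ → ℂ}

/-- A solution of the Loewner equation of `W` with lifetime at most `t` is a solution of the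
equation of any driving function `U` that agrees with `W` on `[0, t]` (the two vector fields
coincide at the relevant times). [cite: Lawler2005, Ch. 4 §4.1] -/
theorem IsSolution.of_eqOn_driving {T : WithTop ℝ≥0} {t : ℝ≥0} (h : IsSolution W z g T)
    (hT : T ≤ (t : WithTop ℝ≥0)) (heq : ∀ s, s ≤ t → W s = U s) : IsSolution U z g T := by
  have hWU : ∀ s : ℝ, 0 ≤ s → (s.toNNReal : WithTop ℝ≥0) < T → W s.toNNReal = U s.toNNReal := by
    intro s _ hsT
    apply heq
    have : (s.toNNReal : WithTop ℝ≥0) < t := hsT.trans_le hT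
    exact (WithTop.coe_lt_coe.1 this).le
  refine ⟨h.apply_zero, fun s hs ↦ ?_, fun s hs hsT ↦ ?_⟩
  · have h1 := h.isIntegralCurveOn s hs
    have h2 : vectorField U s (g s) = vectorField W s (g s) := by
      rw [vectorField_apply, vectorField_apply, hWU s hs.1 hs.2]
    rw [h2]
    exact h1
  · rw [← hWU s hs hsT]
    exact h.ne hs hsT

/-- **`t < T_z` is decided by the driving function up to time `t`**: for continuous `W`, `U`
agreeing on `[0, t]`, `t < T_z(W)` implies `t < T_z(U)` (the maximal `W`-solution solves the
`U`-equation on `[0, t)` and stays a positive distance away from `U = W` on `[0, t]`, so it is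
extendable: `IsSolution.coe_lt_swallowingTime_of_le_norm_sub`). [cite: Lawler2005, Ch. 4 §4.1] -/
theorem coe_lt_swallowingTime_of_eqOn (hW : Continuous W) (hU : Continuous U) {t : ℝ≥0}
    (heq : ∀ s, s ≤ t → W s = U s) (ht : (t : WithTop ℝ≥0) < swallowingTime W z) :
    (t : WithTop ℝ≥0) < swallowingTime U z := by
  have hz : z ≠ W 0 := ne_driving_of_lt_swallowingTime ht
  rcases eq_or_lt_of_le (show (0 : ℝ≥0) ≤ t from bot_le) with h0 | ht0
  · subst h0
    rw [heq 0 le_rfl] at hz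
    exact swallowingTime_pos_holds hU hz
  · obtain ⟨g, hg⟩ := exists_isSolution_swallowingTime_holds hW hz
    have hgU : IsSolution U z g t := (hg.mono ht.le).of_eqOn_driving le_rfl heq
    obtain ⟨δ, hδ, hfar⟩ := hg.exists_le_norm_sub hW t.coe_nonneg (toNNReal_coe_lt ht)
    refine hgU.coe_lt_swallowingTime_of_le_norm_sub hU ht0 hδ fun s hs0 hst ↦ ?_
    have h1 := hfar s ⟨hs0, hst.le⟩
    rwa [heq _ (Real.toNNReal_le_iff_le_coe.2 hst.le)] at h1

/-- **The Loewner map up to time `t` is decided by the driving function up to time `t`**: for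
continuous `W`, `U` agreeing on `[0, t]` and `t < T_z(W)`, `g^U_s(z) = g^W_s(z)` for all `s ≤ t`
(uniqueness of solutions, and continuity at the endpoint `s = t`). [cite: Lawler2005, Ch. 4 §4.1] -/
theorem map_eq_of_eqOn (hW : Continuous W) (hU : Continuous U) {t : ℝ≥0}
    (heq : ∀ s, s ≤ t → W s = U s) (ht : (t : WithTop ℝ≥0) < swallowingTime W z) {s : ℝ≥0}
    (hs : s ≤ t) : map U s z = map W s z := by
  have hz : z ≠ W 0 := ne_driving_of_lt_swallowingTime ht
  have hzU : z ≠ U 0 := by rwa [heq 0 bot_le] at hz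
  rcases eq_or_lt_of_le (show (0 : ℝ≥0) ≤ t from bot_le) with h0 | ht0
  · subst h0
    have hs0 : s = 0 := le_antisymm hs bot_le
    subst hs0
    rw [map_zero_apply hW hz, map_zero_apply hU hzU]
  obtain ⟨g, hg⟩ := exists_isSolution_swallowingTime_holds hW hz
  have htU := coe_lt_swallowingTime_of_eqOn hW hU heq ht
  obtain ⟨g', hg'⟩ := exists_isSolution_swallowingTime_holds hU hzU
  -- `g` solves the `U`-equation on `[0, t)`, so `g = g'` there
  have hgU : IsSolution U z g t := (hg.mono ht.le).of_eqOn_driving le_rfl heq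
  have heqOn : EqOn g g' (Ico (0 : ℝ) t) := by
    intro r hr
    have hmem : r ∈ {r : ℝ | 0 ≤ r ∧ (r.toNNReal : WithTop ℝ≥0) < min (t : WithTop ℝ≥0)
        (swallowingTime U z)} := by
      refine ⟨hr.1, lt_min ?_ ?_⟩
      · exact WithTop.coe_lt_coe.2 ((Real.toNNReal_lt_iff_lt_coe hr.1).2 hr.2)
      · exact lt_of_lt_of_le (WithTop.coe_lt_coe.2 ((Real.toNNReal_lt_iff_lt_coe hr.1).2 hr.2)) htU.le
    exact IsSolution.eqOn_holds hU hgU hg' hmem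
  -- extend the equality to `[0, t]` by continuity
  have hsubW := Icc_subset_timeDomain (toNNReal_coe_lt ht)
  have hsubU := Icc_subset_timeDomain (toNNReal_coe_lt htU)
  have heqIcc : EqOn g g' (Icc (0 : ℝ) t) := by
    refine heqOn.of_subset_closure (hg.continuousOn.mono hsubW) (hg'.continuousOn.mono hsubU)
      Ico_subset_Icc_self ?_
    rw [closure_Ico (by exact_mod_cast ht0.ne)]
  have hsW : (s : WithTop ℝ≥0) < swallowingTime W z := lt_of_le_of_lt (WithTop.coe_le_coe.2 hs) ht
  have hsU : (s : WithTop ℝ≥0) < swallowingTime U z := lt_of_le_of_lt (WithTop.coe_le_coe.2 hs) htU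
  rw [map_eq_of_isSolution hW hg hsW, map_eq_of_isSolution hU hg' hsU]
  exact (heqIcc ⟨s.coe_nonneg, NNReal.coe_le_coe.2 hs⟩).symm

/-- **The frozen real flow up to time `t` is decided by the driving function up to time `t`**:
for continuous `W`, `U` agreeing on `[0, t]`, `realFlowStop U x s = realFlowStop W x s` for all
`s ≤ t`. [cite: Lawler2005, Ch. 4 §4.1] -/
theorem realFlowStop_eq_of_eqOn (hW : Continuous W) (hU : Continuous U) {t : ℝ≥0}
    (heq : ∀ s, s ≤ t → W s = U s) {x : ℝ} {s : ℝ≥0} (hs : s ≤ t) :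
    realFlowStop U x s = realFlowStop W x s := by
  have heqs : ∀ r, r ≤ s → W r = U r := fun r hr ↦ heq r (hr.trans hs)
  by_cases hsW : (s : WithTop ℝ≥0) < swallowingTime W x
  · have hsU : (s : WithTop ℝ≥0) < swallowingTime U x :=
      coe_lt_swallowingTime_of_eqOn hW hU heqs hsW
    rw [realFlowStop_of_lt hsU, realFlowStop_of_lt hsW, realFlow_apply, realFlow_apply,
      map_eq_of_eqOn hW hU heqs hsW le_rfl, heq s hs]
  · have hsU : ¬ (s : WithTop ℝ≥0) < swallowingTime U x := fun h ↦
      hsW (coe_lt_swallowingTime_of_eqOn hU hW (fun r hr ↦ (heqs r hr).symm) h)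
    rw [realFlowStop_of_le (not_lt.1 hsW), realFlowStop_of_le (not_lt.1 hsU)]

end Locality

/-! ### The regularised driving path up to time `t` and the flow of a driving process -/

section FlowProc

open Literature.Probability.Process

variable {Ω : Type*} {mΩ : MeasurableSpace Ω}

/-- The regularisation fixes the value at time `0` (a dyadic time). [folklore] -/
theorem pathRegularize_apply_zero (w : ℝ≥0 → ℝ) : pathRegularize w 0 = w 0 := by
  by_cases hw : KolmogorovChentsov.LocallyUniformOnDyadics w
  · have h := tendsto_pathRegularize hw 0
    have hconst : (fun m : ℕ ↦ w (KolmogorovChentsov.dyad m ⌊((0 : ℝ≥0) : ℝ) * 2 ^ m⌋₊)) =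
        fun _ ↦ w 0 := by
      funext m
      simp [KolmogorovChentsov.dyad]
    rw [hconst] at h
    exact tendsto_nhds_unique h tendsto_const_nhds
  · exact pathRegularize_of_not hw 0

variable (V : ℝ≥0 → Ω → ℝ) (t : ℝ≥0)

/-- **The regularised driving path up to time `t`**: the path `s ↦ V (s ∧ t) ω` of the process `V`
stopped at `t`, regularised by `pathRegularize` (so that it is continuous for every `ω`, and equal to
the stopped path whenever that is continuous). [folklore] -/
def drivingUpTo (ω : Ω) : ℝ≥0 → ℝ :=
  pathRegularize fun s ↦ V (min s t) ω

variable {V t}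

/-- Every regularised driving path is continuous. [folklore] -/
theorem continuous_drivingUpTo (V : ℝ≥0 → Ω → ℝ) (t : ℝ≥0) (ω : Ω) :
    Continuous (drivingUpTo V t ω) :=
  continuous_pathRegularize _

/-- On a continuous path the regularised driving path is the stopped path. [folklore] -/
theorem drivingUpTo_eq_of_continuous {ω : Ω} (hc : Continuous fun s ↦ V s ω) (t : ℝ≥0) :
    drivingUpTo V t ω = fun s ↦ V (min s t) ω :=
  pathRegularize_eq_self_of_continuous (hc.comp (continuous_id.min continuous_const))

/-- The regularised driving path starts where the process starts. [folklore] -/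
theorem drivingUpTo_apply_zero (V : ℝ≥0 → Ω → ℝ) (t : ℝ≥0) (ω : Ω) :
    drivingUpTo V t ω 0 = V 0 ω := by
  rw [drivingUpTo, pathRegularize_apply_zero]
  simp

/-- Every value of the regularised driving path up to time `t` is measurable with respect to any
σ-algebra making the values `V s`, `s ≤ t`, measurable. [folklore] -/
theorem measurable_drivingUpTo_apply (hmeas : ∀ s, s ≤ t → Measurable fun ω ↦ V s ω) (s : ℝ≥0) :
    Measurable fun ω ↦ drivingUpTo V t ω s :=
  (measurable_pathRegularize s).comp
    (measurable_pi_lambda _ fun r ↦ hmeas (min r t) (min_le_right _ _))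

variable (V) in
/-- **The frozen real flow of a driving process** `V` (time first) from the real point `x`, read at
time `t` through the regularised driving path up to time `t`:
`flowProc V x t ω = realFlowStop (drivingUpTo V t ω) x t`. On continuous paths it is the honest
frozen real flow `X_t = g_t(x) - V_t` (`0` from the swallowing time on), and it is adapted.
[cite: Lawler2005, Ch. 4 §4.1] -/
def flowProc (x : ℝ) (t : ℝ≥0) (ω : Ω) : ℝ :=
  realFlowStop (drivingUpTo V t ω) x t

/-- **On a continuous path the flow process is the frozen real flow of the path.** [cite: Lawler2005, Ch. 4 §4.1] -/
theorem flowProc_eq_of_continuous {ω : Ω} (hc : Continuous fun s ↦ V s ω) (x : ℝ) (t : ℝ≥0) :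
    flowProc V x t ω = realFlowStop (fun s ↦ V s ω) x t := by
  unfold flowProc
  rw [drivingUpTo_eq_of_continuous hc]
  exact realFlowStop_eq_of_eqOn (W := fun s ↦ V s ω) (U := fun s ↦ V (min s t) ω) hc
    (hc.comp (continuous_id.min continuous_const)) (fun s hs ↦ by simp [min_eq_left hs]) le_rfl

/-- **The flow process at time `t` is measurable** with respect to any σ-algebra making the values
`V s`, `s ≤ t`, measurable (`x > 0 = V 0`): `Loewner.measurable_realFlowTrunc` applied to the
family of (continuous) regularised driving paths up to time `t`. [cite: Lawler2005, Ch. 4 §4.1] -/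
theorem measurable_flowProc (h0 : ∀ ω, V 0 ω = 0) (hmeas : ∀ s, s ≤ t → Measurable fun ω ↦ V s ω)
    {x : ℝ} (hx : 0 < x) : Measurable fun ω ↦ flowProc V x t ω := by
  have h := measurable_realFlowTrunc (W := fun ω ↦ drivingUpTo V t ω) (t := t)
    (fun ω ↦ continuous_drivingUpTo V t ω) (fun ω ↦ by rw [drivingUpTo_apply_zero, h0])
    (fun s _ ↦ measurable_drivingUpTo_apply hmeas s) hx
  have heq : (fun ω ↦ flowProc V x t ω) = fun ω ↦
      if (t : WithTop ℝ≥0) < swallowingTime (drivingUpTo V t ω) x then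
        (map (drivingUpTo V t ω) t x).re - drivingUpTo V t ω t else 0 := by
    funext ω
    simp only [flowProc, realFlowStop, realFlow_apply]
  rw [heq]
  exact h

/-- **The flow process of an adapted driving process is adapted** (`x > 0 = V 0`). [cite: Lawler2005, Ch. 4 §4.1] -/
theorem adapted_flowProc {𝓕 : Filtration ℝ≥0 mΩ} (hV : Adapted 𝓕 V) (h0 : ∀ ω, V 0 ω = 0)
    {x : ℝ} (hx : 0 < x) : Adapted 𝓕 (flowProc V x) := fun t ↦
  measurable_flowProc (mΩ := 𝓕 t) h0 (fun s hs ↦ (hV s).mono (𝓕.mono hs) le_rfl) hx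

/-- On a continuous path with `V 0 ω < x`, the flow process has a continuous path. [folklore] -/
theorem continuous_flowProc {ω : Ω} (hc : Continuous fun s ↦ V s ω) {x : ℝ} (hx : V 0 ω < x) :
    Continuous fun t ↦ flowProc V x t ω := by
  have : (fun t ↦ flowProc V x t ω) = realFlowStop (fun s ↦ V s ω) x :=
    funext fun t ↦ flowProc_eq_of_continuous hc x t
  rw [this]
  exact continuous_realFlowStop hc hx

/-- On a continuous path with `V 0 ω < x`, the flow process is non-negative. [folklore] -/
theorem flowProc_nonneg {ω : Ω} (hc : Continuous fun s ↦ V s ω) {x : ℝ} (hx : V 0 ω < x)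
    (t : ℝ≥0) : 0 ≤ flowProc V x t ω := by
  rw [flowProc_eq_of_continuous hc]
  exact realFlowStop_nonneg hc hx t

end FlowProc

end Loewner

end Literature.Probability.RandomPlanarGeometry

end
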